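import Summits.QuantumAdvantage.QuantumAdvantage.Theorems.AvgFaceBeyondPrior.Negative.AvgFaceBeyondPriorNecessary
import Summits.QuantumAdvantage.QuantumAdvantage.Theorems.AvgFaceBeyondPrior.Negative.AvgFaceBeyondPriorBlocks
import Literature.Computability.Complexity.BranchingFn

/-!
# `AvgFaceBeyondPrior` (stmt-QuantumAdvantage-2427), negative side: the crux forces
`p_n > 1/3` beyond every level (finite patching)

Sharpening of `avgFace_imp_exists_level` (`AvgFaceBeyondPriorNecessary.lean`): the constant
predictor `3 ∤ h` patched by the exact table of `IQ3` on the levels `< N` is still PPT — a finite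
lookup table is in `FP` (`tableFn_mem_FP`: string equality `eqPairFn`, branching `iteFn`,
constants, from the tree's toolkit) — so the crux forces, for EVERY `N`, a level `n ≥ N` with
`#fundBlock n < 3 · #{d ∈ fundBlock n | 3 ∣ h(−d)}` (`avgFace_imp_exists_level_ge`). This is the
exact arithmetic floor of the crux (the planners' `CruxImpliesThreeDividesOften`, `γ = 0`):
numerically evident (Cohen–Lenstra `0.43987`; exact PARI table, kit j010646: `p_n > 1/3` at `n = 5` and at every
`12 ≤ n ≤ 24`, `p_24 = 0.419`), but in print — to this seat's knowledge —
not even a positive proportion of imaginary quadratic fields with `3 ∣ h` is known, so any proof of the crux proves new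
arithmetic statistics or embeds a certified computation. (cdisprove seat, 2026-08-16.)
-/

namespace Summit.QuantumAdvantage.QuantumAdvantage.Theorems.AvgFaceBeyondPrior.Negative

open _root_.Computability
open Literature.Computability.Complexity Literature.Computability.MetaComplexity
open Literature.NumberTheory.QuadraticFields
open Summit.QuantumAdvantage.QuantumAdvantage.Theses.ArithStatLadder
open Summit.QuantumAdvantage.QuantumAdvantage.Theorems.AvgFaceBeyondPrior.Negative.Blocks
open scoped Classical ENNReal

/-- If no point of the block lies in `E`, the `Uₙ`-probability of `E` is `0` (instance-robust
form of `ens_prob_eq` for this use). [folklore] -/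
theorem ens_prob_eq_zero_of {n : ℕ} (h : (fundBlock n).Nonempty) {E : Set (List Bool)}
    (hE : ∀ d ∈ fundBlock n, encodeNat d ∉ E) : ens.prob n E = 0 := by
  rw [ens_prob_eq h, Finset.filter_eq_empty_iff.2 (fun d hd hmem => hE d hd hmem)]
  simp

/-! ## Finite tables are PPT; the patched predictor

The constant predictor patched by a finite lookup table on the levels `n < N` is still PPT
(string equality + branching from the tree's `FP` toolkit), so the crux forces a bad level
`n ≥ N` for every `N`: `AvgFaceBeyondPrior → ∀ N, ∃ n ≥ N, #fundBlock n < 3·#{3 ∣ h(−d)}`. This is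
the planners' `CruxImpliesThreeDividesOften` (idea card planted-cubic-top-rung, P5) with `γ = 0`,
i.e. exactly the arithmetic floor any proof must supply; conversely the cards' glue shows
top-rung pseudorandomness + "`p_n ≥ 1/3 + γ` infinitely often" ⇒ crux. -/

/-- The single-level necessary condition `avgFace_imp_exists_level` is met OUTRIGHT at `n = 5`
(block `{19, 20, 23, 24, 31}`, `3 ∣ h(−23), h(−31) = 3`: `5 < 3·2`, kernel `decide`), so it carries
no open content; the content sits in the `∀ N` version below, whose witnesses past `N = 6` start at
`n = 12` (PARI j010646: `620 < 3·211`, `1244 < 3·446`, …, `2549853 < 3·1069021` at `n = 24`) and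
are Cohen–Lenstra territory beyond the table. [folklore] -/
theorem exists_level_five :
    (fundBlock 5).Nonempty ∧ ((fundBlock 5).card : ℝ) <
      3 * ((fundBlock 5).filter fun d : ℕ => 3 ∣ BinaryQuadraticForm.classNumber (-(d:ℤ))).card := by
  have h5 : fundBlock 5 = (Finset.Ico (2 ^ 4) (2 ^ 5)).filter (fun d => isFundNegNat (2 ^ 3) d = true) :=
    fundBlock_eq_natForm 5 3 (by norm_num)
  have hc : (fundBlock 5).card = 5 := by rw [h5]; decide
  have hf : ((fundBlock 5).filter fun d : ℕ => 3 ∣ BinaryQuadraticForm.classNumber (-(d:ℤ))).card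
      = 2 := by
    rw [h5, Finset.filter_filter]; decide +kernel
  refine ⟨Finset.card_pos.1 (by rw [hc]; norm_num), ?_⟩
  rw [hc, hf]; norm_num

section Patch

open Finset

/-- Equality with a fixed string as a one-bit string function: `z ↦ [z = u]`. [folklore] -/
noncomputable def eqConstFn (u : List Bool) : List Bool → List Bool :=
  eqPairFn ∘ fanoutFn id (fun _ => u)

/-- `eqConstFn u z = [decide (z = u)]`. [folklore] -/
theorem eqConstFn_apply (u z : List Bool) : eqConstFn u z = [decide (z = u)] := by
  simp only [eqConstFn, Function.comp_apply, fanoutFn_apply, eqPairFn_boolPair, id]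

/-- `eqConstFn u ∈ FP` (equality test after a fan-out with a constant). [cite: AroraBarak2009, §1.3] -/
theorem eqConstFn_mem_FP (u : List Bool) : eqConstFn u ∈ FP :=
  PolyTimeComputable.comp_holds eqPairFn_mem_FP
    (fanoutFn_mem_FP (PolyTimeComputable.id _) (const_mem_FP u))

/-- A finite lookup table as a one-bit string function: `z ↦ [z ∈ l]`. [folklore] -/
noncomputable def tableFn : List (List Bool) → List Bool → List Bool
  | [] => fun _ => [false]
  | u :: us => iteFn (eqConstFn u) (fun _ => [true]) (tableFn us)

/-- `tableFn l z = [decide (z ∈ l)]`. [folklore] -/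
theorem tableFn_apply (l : List (List Bool)) (z : List Bool) : tableFn l z = [decide (z ∈ l)] := by
  induction l with
  | nil => simp [tableFn]
  | cons u us ih =>
    rw [tableFn, iteFn_apply (eqConstFn_apply u z), ih]
    by_cases h : z = u
    · subst h; simp
    · simp [h]

/-- **Finite tables are polynomial time** (`iteFn`/`eqPairFn`/constants of the tree's `FP`
toolkit, by induction on the table). [cite: AroraBarak2009, §1.3] -/
theorem tableFn_mem_FP (l : List (List Bool)) : tableFn l ∈ FP := by
  induction l with
  | nil => exact const_mem_FP [false]
  | cons u us ih => exact iteFn_mem_FP (eqConstFn_mem_FP u) (const_mem_FP [true]) ih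

/-- The finitely patched constant predictor: accept iff the encoded input `⟨x, 1ⁿ⟩` is in the
table `l`, reject otherwise. [folklore] -/
noncomputable def patchAlg (l : List (List Bool)) : RandAlg (List Bool × ℕ) Bool :=
  RandAlg.ofDet fun p => decide (paramEnc p ∈ l)

/-- The patched predictor is PPT. [cite: AroraBarak2009, §1.3] -/
theorem isPolyTime_patchAlg (l : List (List Bool)) : (patchAlg l).IsPolyTime paramEnc encodeBool := by
  refine RandAlg.IsPolyTime.ofDet_holds ?_
  exact (tableFn_mem_FP l).of_comp_encode paramEnc (fun _ => rfl) fun p => by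
    rw [tableFn_apply]; rfl

/-- Bad set of a coin-free algorithm: the inputs where its answer is wrong. [folklore] -/
theorem badSet_ofDet (f : List Bool × ℕ → Bool) (n : ℕ) :
    {x | (1:ℝ) / 4 ≤ (RandAlg.ofDet f).pr paramEnc (x, n) {b | b ≠ iq3Lang.boolIndicator x}} =
      {x | f (x, n) ≠ iq3Lang.boolIndicator x} := by
  ext x
  simp only [Set.mem_setOf_eq, RandAlg.pr_ofDet, ne_eq]
  by_cases hx : f (x, n) = iq3Lang.boolIndicator x
  · simp only [hx, not_true_eq_false, if_false]
    norm_num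
  · simp only [hx, not_false_eq_true, if_true]
    norm_num

/-- `paramEnc` is injective in both arguments. [folklore] -/
theorem paramEnc_inj {x x' : List Bool} {n n' : ℕ} (h : paramEnc (x, n) = paramEnc (x', n')) :
    x = x' ∧ n = n' := by
  have h2 := boolPair_injective (a₁ := (x, unaryEncodeNat n)) (a₂ := (x', unaryEncodeNat n')) h
  simp only [Prod.mk.injEq] at h2
  refine ⟨h2.1, ?_⟩
  have := congrArg unaryDecodeNat h2.2
  rwa [unary_decode_encode_nat, unary_decode_encode_nat] at this

/-- **The crux forces a level with more than a third `3 ∣ h(−d)` BEYOND ANY `N`** (so infinitely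
often): patch the constant predictor `3 ∤ h` by the exact table of `IQ3` on the levels `< N`
(`patchAlg`, PPT by `isPolyTime_patchAlg`); it has bad mass `0` below `N` and bad set `IQ3` from
`N` on. Necessary arithmetic content of the crux; numerically true, while in print (to this seat's
knowledge; Davenport–Heilbronn gives only `≥ 1/2` for `3 ∤ h` and power-saving counts for `3 ∣ h`)
not even "a positive proportion of imaginary quadratic fields have `3 ∣ h`" is known. [folklore] -/
theorem avgFace_imp_exists_level_ge (h : AvgFaceBeyondPrior) (N : ℕ) :
    ∃ n, N ≤ n ∧ (fundBlock n).Nonempty ∧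
      ((fundBlock n).card : ℝ) <
        3 * ((fundBlock n).filter fun d : ℕ => 3 ∣ BinaryQuadraticForm.classNumber (-(d:ℤ))).card := by
  -- the table: encoded inputs ⟨bin d, 1ᵐ⟩ with m < N, d ∈ fundBlock m ∩ IQ3
  set S : Finset (List Bool) := (range N).biUnion fun m =>
    ((fundBlock m).filter fun d => d ∈ iq3Set).image fun d => paramEnc (encodeNat d, m) with hS
  have hmemS : ∀ x m, paramEnc (x, m) ∈ S ↔ m < N ∧ ∃ d ∈ fundBlock m, d ∈ iq3Set ∧ x = encodeNat d := by
    intro x m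
    simp only [hS, mem_biUnion, mem_range, mem_image, mem_filter]
    constructor
    · rintro ⟨m', hm', d, ⟨hd, hd3⟩, he⟩
      obtain ⟨hx, hmm⟩ := paramEnc_inj he
      subst hmm
      exact ⟨hm', d, hd, hd3, hx.symm⟩
    · rintro ⟨hm, d, hd, hd3, rfl⟩
      exact ⟨m, hm, d, ⟨hd, hd3⟩, rfl⟩
  obtain ⟨n, hn⟩ := (avgFace_iff.1 h) (patchAlg S.toList) (isPolyTime_patchAlg S.toList)
  rw [patchAlg, badSet_ofDet] at hn
  by_cases hnN : n < N
  · -- below N the table is exact on the support: bad mass 0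
    exfalso
    have hgood : ∀ d ∈ fundBlock n,
        decide (paramEnc (encodeNat d, n) ∈ S.toList) = iq3Lang.boolIndicator (encodeNat d) := by
      intro d hd
      have hiff : paramEnc (encodeNat d, n) ∈ S.toList ↔ encodeNat d ∈ iq3Lang := by
        rw [Finset.mem_toList, hmemS, encodeNat_mem_iq3Lang]
        constructor
        · rintro ⟨-, d', -, hd3, he⟩
          rwa [encodingNatBool.encode_injective he]
        · exact fun h3 => ⟨hnN, d, hd, h3, rfl⟩
      by_cases hx : encodeNat d ∈ iq3Lang
      · rw [(Set.mem_iff_boolIndicator (s := iq3Lang) _).1 hx, decide_eq_true (hiff.2 hx)]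
      · rw [(Set.notMem_iff_boolIndicator (s := iq3Lang) _).1 hx, decide_eq_false (fun h' => hx (hiff.1 h'))]
    by_cases hne : (fundBlock n).Nonempty
    · rw [ens_prob_eq_zero_of hne (E := {x | decide (paramEnc (x, n) ∈ S.toList) ≠
        iq3Lang.boolIndicator x}) (fun d hd hbad => hbad (hgood d hd))] at hn
      norm_num at hn
    · rw [ens_prob_of_not_nonempty hne] at hn
      have hnil : ([] : List Bool) ∉
          {x | decide (paramEnc (x, n) ∈ S.toList) ≠ iq3Lang.boolIndicator x} := by
        intro hbad
        apply hbad
        rw [(Set.notMem_iff_boolIndicator (s := iq3Lang) _).1 nil_not_mem_iq3Lang]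
        refine decide_eq_false fun hmem => ?_
        rw [Finset.mem_toList, hmemS] at hmem
        obtain ⟨-, d, hd, -, he⟩ := hmem
        have hd1 : 1 ≤ d := le_trans (Nat.one_le_two_pow) (mem_Ico.1 (mem_filter.1 hd).1).1
        have hdec := congrArg decodeNat he
        rw [decode_encodeNat] at hdec
        have h00 : decodeNat [] = 0 := by decide
        omega
      rw [if_neg hnil] at hn
      norm_num at hn
  · -- from N on the table is silent: the algorithm is the constant predictor
    push Not at hnN
    have hsilent : ∀ x, decide (paramEnc (x, n) ∈ S.toList) = false := by
      intro x
      refine decide_eq_false fun hmem => ?_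
      rw [Finset.mem_toList, hmemS] at hmem
      omega
    have hset : {x | decide (paramEnc (x, n) ∈ S.toList) ≠ iq3Lang.boolIndicator x} = iq3Lang := by
      ext x
      simp only [Set.mem_setOf_eq, hsilent x, ne_eq]
      constructor
      · intro hx
        by_contra hx'
        exact hx ((Set.notMem_iff_boolIndicator (s := iq3Lang) _).1 hx').symm
      · intro hx
        rw [(Set.mem_iff_boolIndicator (s := iq3Lang) _).1 hx]
        exact Bool.false_ne_true
    rw [hset] at hn
    by_cases hne : (fundBlock n).Nonempty
    · refine ⟨n, hnN, hne, ?_⟩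
      rw [ens_prob_eq hne] at hn
      have hcard : (0:ℝ) < (fundBlock n).card := by exact_mod_cast hne.card_pos
      rw [lt_div_iff₀ hcard] at hn
      have hfilter : ((fundBlock n).filter fun d => encodeNat d ∈ iq3Lang) =
          (fundBlock n).filter fun d : ℕ => 3 ∣ BinaryQuadraticForm.classNumber (-(d:ℤ)) := by
        refine Finset.filter_congr fun d hd => ?_
        rw [encodeNat_mem_iq3Lang]
        exact ⟨fun h => h.2, fun h => ⟨(Finset.mem_filter.1 hd).2, h⟩⟩
      rw [hfilter] at hn
      linarith
    · rw [ens_prob_of_not_nonempty hne, if_neg nil_not_mem_iq3Lang] at hn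
      norm_num at hn

end Patch

end Summit.QuantumAdvantage.QuantumAdvantage.Theorems.AvgFaceBeyondPrior.Negative
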